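/-
Copyright: public-audit package `pub-balaban` (b2b-balaban), seat pv09-g4. Released under Apache 2.0 like Mathlib.
-/
import Literature.MathematicalPhysics.QuantumFieldTheory.Balaban1983to89.B6LayerPoincare
import Literature.MathematicalPhysics.QuantumFieldTheory.Balaban1983to89.B6AveragingBound
import Literature.MathematicalPhysics.QuantumFieldTheory.Balaban1983to89.B6Lemma24Carrier

/-!
# B6, (2.126)–(2.127) per coarse bond, with the layer constant κ₀, on the concrete carrier

Source under audit: T. Bałaban, *Propagators and renormalization transformations for lattice gauge theories.
II*, Commun. Math. Phys. **96** (1984) 223–250 [B6], proof of Lemma 2.4, p. 245.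

## Text (verbatim, p. 245; render `1984-cmp96-propagators-rt-II-p023-x2.png` READ AS IMAGE)

*"From these two inequalities we obtain*
*L^{−d} Σ_{p⊂B(c)} |(∂₁B)(p)|² + |(Q₁B)(c)|² ≥ ⅓ (L^{−d} Σ_{b⊂Δ′} |(∂B_μ)(b)|² + L^{−2} |Σ_{x∈Δ′} L^{−(d−1)}B_μ(x)|²)*
*− L^{−d} Σ_{b⊂B(c₋)} |B(b)|² − L^{−d} Σ_{b⊂B(c₊)} |B(b)|². (2.126)*
*The terms in parentheses on the right-hand side can be written as L^{−2}⟨B, (Δ_{Δ′}^{L^{−1},N} + Q′*_{Δ′}Q′_{Δ′})B⟩,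
where the operators are defined on a d − 1-dimensional lattice. This quadratic form is bounded from below by
L^{−d−1} Σ_{x∈Δ′} |B_μ(x)|², hence*
*L^{−d} Σ_{p⊂B(c)} |(∂₁B)(p)|² + |(Q₁B)(c)|² ≥ ⅓ L^{−d−1} Σ_{b∈B(c)} |B(b)|² − L^{−d} Σ_{b⊂B(c₋)} |B(b)|²
− L^{−d} Σ_{b⊂B(c₊)} |B(b)|². (2.127)"*

("these two inequalities" = (2.124), (2.125); c = ⟨y, y + Le_μ⟩, c₋ = y, c₊ = y + Le_μ; Δ′ = the last layer of
B(c₋), Δ″ = Δ′ + e_μ the first layer of B(c₊); "b ∈ B(c)" = the crossing bonds ⟨x, x + e_μ⟩, x ∈ Δ′.  The printed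
(2.126) has ALREADY absorbed the boundary families of (2.124) (Σ_{b⊂Δ′}, Σ_{b⊂Δ″} |B(b)|²) and of (2.125)
(Σ_{⟨x,x+e_μ⟩⊂B(c∓)} |B_μ(x)|²) into Σ_{b⊂B(c∓)} |B(b)|².  DOCFIX v1.1: v1 of this file, p180980, displayed at
this place under the heading «verbatim» the UN-absorbed combination (2.124)×L^{−d} + (2.125), with square
brackets, and a paraphrase of the linking sentence — not the printed text; withdrawn (x-read G-pv27-1 by
pv27-g3).  The sentence "This quadratic form is bounded from below by …" is the one refuted for L = 10 by
`B6.claim_p245_fails_L10` and quoted with its status in `B6LayerPoincare`.)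

## What this file proves

The sentence between (2.126) and (2.127) is false as printed for L ≥ 10 (`B6.claim_p245_fails_L10`); its
repaired form with the constant κ₀ = κ₀(d, L) of `B6LayerPoincare.kappa0` is the kernel theorem
`B6LayerPoincare.layerPoincare`.  Combining it with the kernel theorems `B6FaceInterpolation.ineq2124` ((2.124))
and `B6AveragingBound.ineq2125` ((2.125), intended sign) gives, for EVERY configuration B (no gauge condition is
used at this step), every d ≥ 2, L ≥ 1, y ∈ ℤ^d and μ — `face2127`:

  κ₀ L^{−d−1} Σ_{x∈Δ′} B_μ(x)² − 3L^{−d} [Σ_{b⊂B(c₋)} B(b)² + Σ_{b⊂B(c₊)} B(b)²]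
    ≤ 3 [L^{−d} Σ_{b⊂Δ′} (∂₁B)(p(b))² + |(Q₁B)(c)|²],

i.e. (2.127) with ⅓ ↦ κ₀/3 (times 3), where Σ_{b⊂B(y′)} runs over ALL bonds inside the block
(`B6TreeGaugePoincare.innerBonds`, the family of (2.123)), the plaquette sum runs over the plaquettes p(b) ⊂ B(c)
of (2.124) (`B6FaceInterpolation.bondsIn (lastLayer L y μ)`, value `curl B b.1 b.2 μ`), and |(Q₁B)(c)|² is the
summand `B6Lemma24Carrier.q1Term L B (y, μ)` of the concrete carrier.  The boundary families of (2.124) and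
(2.125) are absorbed into Σ_{b⊂B(c∓)} B(b)² by `absorb` (they are disjoint families of bonds inside the block),
exactly as print does in passing to (2.126).

## HONEST SCOPE

This is the per-face step only; the summation over the coarse bonds c (every block is c₋ of d and c₊ of d coarse
bonds; the face plaquette families are disjoint and disjoint from the block-interior plaquettes) that turns it
into `B6.Step2127 d L κ₀` for the carrier, and hence `B6.Lemma24K d L κ₀`, is NOT in this file.  The constant is
κ₀ = 1/(4 + 6d(L−1)L^{d−2}) (crude; the sharp layer constant is Lλ₁(P_L)λ₁-type, package census G-B6-10), not the
printed 1.
-/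

open Finset

namespace Literature.MathematicalPhysics.QuantumFieldTheory.Balaban1983to89.B6FaceLowerBound

open B6Elimination (block mem_block)
open B6BondElimination (unitVec unitVec_apply add_unitVec_apply add_smul_unitVec_apply)
open B6TreeGaugePoincare (Cfg curl innerBonds mem_innerBonds mem_innerBonds_iff bondStarts mem_bondStarts)
open B6FaceInterpolation (lastLayer firstLayer bondsIn mem_lastLayer mem_firstLayer mem_bondsIn ineq2124
  lastLayer_subset_block firstLayer_subset_block)
open B6LayerPoincare (gradSq kappa0 kappa0_pos layerPoincare)
open B6AveragingBound (ineq2125)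
open B6Lemma24Carrier (q1Term)

noncomputable section

variable {d : ℕ} {L : ℕ}

/-! ## §1  Absorbing the layer bonds and the μ-bonds into Σ_{b⊂B(y′)} B(b)² -/

/-- For a layer S ⊂ B(y′) transversal to μ (all points of S have the same μ-coordinate): the bonds inside S and
the μ-bonds inside B(y′) are disjoint families of bonds inside B(y′), so
Σ_{b⊂S} B(b)² + Σ_{⟨x,x+e_μ⟩⊂B(y′)} B_μ(x)² ≤ Σ_{b⊂B(y′)} B(b)². [folklore] -/
theorem absorb {S : Finset (Fin d → ℤ)} {y' : Fin d → ℤ} {μ : Fin d} {a : ℤ} (hS : S ⊆ block L y')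
    (ha : ∀ x ∈ S, x μ = a) (B : Cfg d) :
    ∑ b ∈ bondsIn S, B b ^ 2 + ∑ x ∈ bondStarts L y' μ, B (x, μ) ^ 2 ≤ ∑ b ∈ innerBonds L y', B b ^ 2 := by
  classical
  have hinj : Set.InjOn (fun x : Fin d → ℤ => (x, μ)) ↑(bondStarts L y' μ) :=
    fun x _ x' _ h => congr_arg Prod.fst h
  have e : ∑ x ∈ bondStarts L y' μ, B (x, μ) ^ 2 =
      ∑ b ∈ (bondStarts L y' μ).image (fun x => (x, μ)), B b ^ 2 :=
    (sum_image (s := bondStarts L y' μ) (g := fun x => (x, μ)) (f := fun b => B b ^ 2) hinj).symm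
  have hdisj : Disjoint (bondsIn S) ((bondStarts L y' μ).image fun x => (x, μ)) :=
    disjoint_left.2 fun b hb hb' => by
      obtain ⟨x, -, rfl⟩ := mem_image.1 hb'
      obtain ⟨h1, h2⟩ := mem_bondsIn.1 hb
      have e1 := ha _ h1
      have e2 := ha _ h2
      simp only at e1 e2
      rw [add_unitVec_apply, if_pos rfl] at e2
      omega
  rw [e, ← sum_union hdisj]
  refine sum_le_sum_of_subset_of_nonneg (fun b hb => ?_) fun _ _ _ => sq_nonneg _
  rcases mem_union.1 hb with hb | hb
  · obtain ⟨h1, h2⟩ := mem_bondsIn.1 hb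
    exact mem_innerBonds_iff.2 ⟨hS h1, hS h2⟩
  · obtain ⟨x, hx, rfl⟩ := mem_image.1 hb
    exact mem_innerBonds.2 (mem_bondStarts.1 hx)

/-- The Δ′-instance: Σ_{b⊂Δ′} B(b)² + Σ_{⟨x,x+e_μ⟩⊂B(c₋)} B_μ(x)² ≤ Σ_{b⊂B(c₋)} B(b)². [folklore] -/
theorem absorb_last (y : Fin d → ℤ) (μ : Fin d) (B : Cfg d) :
    ∑ b ∈ bondsIn (lastLayer L y μ), B b ^ 2 + ∑ x ∈ bondStarts L y μ, B (x, μ) ^ 2 ≤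
      ∑ b ∈ innerBonds L y, B b ^ 2 :=
  absorb (lastLayer_subset_block y μ) (fun _ hx => (mem_lastLayer.1 hx).2) B

/-- The Δ″-instance: Σ_{b⊂Δ″} B(b)² + Σ_{⟨x,x+e_μ⟩⊂B(c₊)} B_μ(x)² ≤ Σ_{b⊂B(c₊)} B(b)². [folklore] -/
theorem absorb_first (y : Fin d → ℤ) (μ : Fin d) (B : Cfg d) :
    ∑ b ∈ bondsIn (firstLayer L y μ), B b ^ 2 + ∑ x ∈ bondStarts L (y + (L : ℤ) • unitVec μ) μ, B (x, μ) ^ 2 ≤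
      ∑ b ∈ innerBonds L (y + (L : ℤ) • unitVec μ), B b ^ 2 :=
  absorb (firstLayer_subset_block y μ) (fun _ hx => (mem_firstLayer.1 hx).2) B

/-! ## §2  (2.126)–(2.127) with κ₀, per coarse bond -/

/-- (L^{−1})² (L^{−(d−1)} U)² = (L^{−d} U)² = (Σ L^{−d} u)² (d ≥ 1): the second term of the layer inequality is the
second term of (2.125)'s bracket. [folklore] -/
theorem sq_rescale (hd : 1 ≤ d) (ℓ : ℝ) (S : Finset (Fin d → ℤ)) (u : (Fin d → ℤ) → ℝ) :
    ℓ ^ 2 * (ℓ ^ (d - 1) * ∑ x ∈ S, u x) ^ 2 = (∑ x ∈ S, ℓ ^ d * u x) ^ 2 := by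
  rw [← mul_sum]
  obtain ⟨k, rfl⟩ : ∃ k, d = k + 1 := ⟨d - 1, by omega⟩
  rw [Nat.add_sub_cancel]
  ring

/-- **(2.127) with the layer constant κ₀, for one coarse bond c = ⟨y, y + Le_μ⟩, on the concrete objects** —
valid for every configuration B (d ≥ 2, L ≥ 1):
κ₀ L^{−d−1} Σ_{x∈Δ′} B_μ(x)² − 3L^{−d}[Σ_{b⊂B(c₋)} B(b)² + Σ_{b⊂B(c₊)} B(b)²] ≤ 3[L^{−d} Σ_{b⊂Δ′} (∂₁B)(p(b))² +
|(Q₁B)(c)|²].  Obtained from (2.124) (`ineq2124`) × L^{−d} + (2.125) (`ineq2125`) with `absorb_last` /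
`absorb_first` (this is (2.126)), then the repaired p.245 sentence (`layerPoincare`) for g = B_μ on Δ′.
[cite: Balaban1984PropagatorsII, (2.126)–(2.127) p.245] -/
theorem face2127 (hd : 2 ≤ d) (hL : 1 ≤ L) (y : Fin d → ℤ) (μ : Fin d) (B : Cfg d) :
    kappa0 d L * ((L : ℝ)⁻¹) ^ (d + 1) * ∑ x ∈ lastLayer L y μ, B (x, μ) ^ 2
      - 3 * ((L : ℝ)⁻¹) ^ d *
        (∑ b ∈ innerBonds L y, B b ^ 2 + ∑ b ∈ innerBonds L (y + (L : ℤ) • unitVec μ), B b ^ 2) ≤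
    3 * (((L : ℝ)⁻¹) ^ d * ∑ b ∈ bondsIn (lastLayer L y μ), curl B b.1 b.2 μ ^ 2 + q1Term L B (y, μ)) := by
  have h1 := ineq2124 hL y μ B
  have h2 := ineq2125 hL y μ B
  have h3 := layerPoincare hd hL y μ (fun z => B (z, μ))
  simp only [gradSq] at h3
  rw [sq_rescale (by omega : 1 ≤ d)] at h3
  have h4 := absorb_last (L := L) y μ B
  have h5 := absorb_first (L := L) y μ B
  have hq : q1Term L B (y, μ) =
      (∑ x ∈ block L y, ((L : ℝ)⁻¹) ^ (d + 1) * ∑ t ∈ range L, B (x + (t : ℤ) • unitVec μ, μ)) ^ 2 := rfl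
  have hℓ : (0 : ℝ) ≤ ((L : ℝ)⁻¹) ^ d := by positivity
  have h1' := mul_le_mul_of_nonneg_left h1 hℓ
  have h4' := mul_le_mul_of_nonneg_left h4 hℓ
  have h5' := mul_le_mul_of_nonneg_left h5 hℓ
  rw [hq]
  linarith

/-- The same in the printed orientation "≥". [cite: Balaban1984PropagatorsII, (2.127) p.245] -/
theorem face2127_ge (hd : 2 ≤ d) (hL : 1 ≤ L) (y : Fin d → ℤ) (μ : Fin d) (B : Cfg d) :
    3 * (((L : ℝ)⁻¹) ^ d * ∑ b ∈ bondsIn (lastLayer L y μ), curl B b.1 b.2 μ ^ 2 + q1Term L B (y, μ)) ≥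
    kappa0 d L * ((L : ℝ)⁻¹) ^ (d + 1) * ∑ x ∈ lastLayer L y μ, B (x, μ) ^ 2
      - 3 * ((L : ℝ)⁻¹) ^ d *
        (∑ b ∈ innerBonds L y, B b ^ 2 + ∑ b ∈ innerBonds L (y + (L : ℤ) • unitVec μ), B b ^ 2) :=
  face2127 hd hL y μ B

end

end Literature.MathematicalPhysics.QuantumFieldTheory.Balaban1983to89.B6FaceLowerBound
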